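import Summits.HubbardSuperconductivity.HubbardSuperconductivity.Theorems.AnisotropyChordTowerPerturbation

/-!
# Part I — the abstract finite-dimensional BOOTSTRAP LEMMA of THEOREM P′ (memo ROTOR-THEORY-11 §156 (L5), §160 (γ2))

Setting: real symmetric `A, W` on `ι → ℝ`, `A φ₀ = 0`, `‖φ₀‖ = 1`, gap `⟨χ,Aχ⟩ ≥ γ‖χ‖²` on `φ₀^⟂`, `|⟨x,Wx⟩| ≤ w_max‖x‖²`,
first-order vector `φ₁ ⟂ φ₀` with `Aφ₁ = −(Wφ₀ − w₀φ₀)`, and `ψ` a unit minimiser of `q_η(b) = ⟨b,(A+ηW)b⟩/‖b‖²`, `0 ≤ η ≤ 1`.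
Conclusion (division-free constants): with `α = ⟨φ₀,ψ⟩`, `ρ = ψ − αφ₀ − ηαφ₁`,
`γ²(1 − α²) ≤ K₄ η²` and `γ³‖ρ‖² ≤ K₅ η³`, where
`c₁ = |⟨φ₁,Wφ₁⟩| + ‖φ₁‖² w_max`, `K₂ = w_max + |w₀| + c₁`, `K₃ = K₂(|w₀| + w_max) + γ c₁`, `K₄ = 2γ²‖φ₁‖² + 2K₃`,
`K₅ = K₄(|w₀| + w_max) + γ² c₁`.
-/

set_option linter.dupNamespace false
set_option autoImplicit false

open Matrix

namespace Summit.HubbardSuperconductivity.HubbardSuperconductivity.Theorems.AnisotropyChord.Tower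

variable {ι : Type} [Fintype ι]

/-- `0 ≤ x ⬝ᵥ x`. [folklore] -/
private theorem dot_self_nonneg (v : ι → ℝ) : 0 ≤ v ⬝ᵥ v :=
  Finset.sum_nonneg fun i _ => mul_self_nonneg (v i)

/-- A polarisation-type bound for the dot product. [folklore] -/
private theorem dot_add_le (u v : ι → ℝ) : (u + v) ⬝ᵥ (u + v) ≤ 2 * (u ⬝ᵥ u) + 2 * (v ⬝ᵥ v) := by
  have h := dot_self_nonneg (u - v)
  simp only [sub_dotProduct, dotProduct_sub, add_dotProduct, dotProduct_add] at h ⊢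
  have hc : v ⬝ᵥ u = u ⬝ᵥ v := dotProduct_comm v u
  linarith

/-- **BOOTSTRAP LEMMA** (Theorem P′ (L5): the sector ground state is `α(φ₀ + ηφ₁) + O(η^{3/2})`).
Constants are passed as parameters fixed by defining equations (instantiate with `rfl`). -/
theorem bootstrap (A W : (ι → ℝ) →ₗ[ℝ] (ι → ℝ))
    (hA : ∀ f g : ι → ℝ, f ⬝ᵥ A g = A f ⬝ᵥ g) (hW : ∀ f g : ι → ℝ, f ⬝ᵥ W g = W f ⬝ᵥ g)
    (φ₀ φ₁ ψ ρ : ι → ℝ) (η w₀ γ wmax α p₁ c₁ K₂ K₃ K₄ K₅ : ℝ)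
    (hAφ₀ : A φ₀ = 0) (h00 : φ₀ ⬝ᵥ φ₀ = 1) (h01 : φ₀ ⬝ᵥ φ₁ = 0)
    (hfirst : A φ₁ = -(W φ₀ - w₀ • φ₀))
    (hγ : 0 < γ) (hgap : ∀ χ : ι → ℝ, φ₀ ⬝ᵥ χ = 0 → γ * (χ ⬝ᵥ χ) ≤ χ ⬝ᵥ A χ)
    (hwmax : 0 ≤ wmax) (hWb : ∀ x : ι → ℝ, |x ⬝ᵥ W x| ≤ wmax * (x ⬝ᵥ x))
    (hη0 : 0 ≤ η) (hη1 : η ≤ 1) (hψ : ψ ⬝ᵥ ψ = 1)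
    (hmin : ∀ b : ι → ℝ, (ψ ⬝ᵥ (A ψ + η • W ψ)) * (b ⬝ᵥ b) ≤ b ⬝ᵥ (A b + η • W b))
    (hαdef : α = φ₀ ⬝ᵥ ψ) (hρdef : ρ = ψ - α • φ₀ - (η * α) • φ₁) (hp₁def : p₁ = φ₁ ⬝ᵥ φ₁)
    (hc₁def : c₁ = |φ₁ ⬝ᵥ W φ₁| + p₁ * wmax) (hK₂def : K₂ = wmax + |w₀| + c₁)
    (hK₃def : K₃ = K₂ * (|w₀| + wmax) + γ * c₁) (hK₄def : K₄ = 2 * γ ^ 2 * p₁ + 2 * K₃)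
    (hK₅def : K₅ = K₄ * (|w₀| + wmax) + γ ^ 2 * c₁) :
    γ ^ 2 * (1 - α ^ 2) ≤ K₄ * η ^ 2 ∧ γ ^ 3 * (ρ ⬝ᵥ ρ) ≤ K₅ * η ^ 3 := by
  -- S0: decomposition bookkeeping
  set χ : ι → ℝ := ψ - α • φ₀ with hχdef
  have hρχ : ρ = χ - (η * α) • φ₁ := by rw [hρdef, hχdef]
  have hψdec : ψ = α • φ₀ + ((η * α) • φ₁ + ρ) := by rw [hρχ, hχdef]; abel
  have hχdec : (η * α) • φ₁ + ρ = χ := by rw [hρχ]; abel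
  have h0χ : φ₀ ⬝ᵥ χ = 0 := by
    simp only [hχdef, dotProduct_sub, dotProduct_smul, h00, smul_eq_mul, mul_one, ← hαdef]; ring
  have h10 : φ₁ ⬝ᵥ φ₀ = 0 := by rw [dotProduct_comm]; exact h01
  have hχ0 : χ ⬝ᵥ φ₀ = 0 := by rw [dotProduct_comm]; exact h0χ
  have h0ρ : φ₀ ⬝ᵥ ρ = 0 := by
    rw [hρχ, dotProduct_sub, dotProduct_smul, h0χ, h01, smul_eq_mul, mul_zero, sub_zero]
  have hψχ : ψ = α • φ₀ + χ := by rw [hχdef]; abel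
  have hχχ : χ ⬝ᵥ χ = 1 - α ^ 2 := by
    have e : ψ ⬝ᵥ ψ = α ^ 2 + χ ⬝ᵥ χ := by
      conv_lhs => rw [hψχ]
      simp only [add_dotProduct, dotProduct_add, smul_dotProduct, dotProduct_smul, h00, h0χ, hχ0, smul_eq_mul,
        mul_one, mul_zero, add_zero, zero_add]
      ring
    linarith [hψ]
  have h1α : 0 ≤ 1 - α ^ 2 := by have := dot_self_nonneg χ; linarith
  have hη2 : 0 ≤ η ^ 2 := by positivity
  have hη3 : 0 ≤ η ^ 3 := by positivity
  have hη21 : η ^ 2 ≤ 1 := by nlinarith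
  have hη31 : η ^ 3 ≤ η := by
    calc η ^ 3 = η * η ^ 2 := by ring
      _ ≤ η * 1 := mul_le_mul_of_nonneg_left hη21 hη0
      _ = η := by ring
  have hη32 : η ^ 3 ≤ η ^ 2 := by
    calc η ^ 3 = η ^ 2 * η := by ring
      _ ≤ η ^ 2 * 1 := mul_le_mul_of_nonneg_left hη1 hη2
      _ = η ^ 2 := by ring
  -- S1: first-order data
  have hw₀ : φ₀ ⬝ᵥ W φ₀ = w₀ := by
    have h := congrArg (fun v => φ₀ ⬝ᵥ v) hfirst
    simp only [dotProduct_neg, dotProduct_sub, dotProduct_smul, h00, smul_eq_mul, mul_one] at h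
    rw [hA, hAφ₀, zero_dotProduct] at h; linarith
  have hp₁ : 0 ≤ p₁ := by rw [hp₁def]; exact dot_self_nonneg φ₁
  have ha₁ : γ * p₁ ≤ φ₁ ⬝ᵥ A φ₁ := by rw [hp₁def]; exact hgap φ₁ h01
  have ha₁0 : 0 ≤ φ₁ ⬝ᵥ A φ₁ := le_trans (mul_nonneg hγ.le hp₁) ha₁
  have hc₁ : 0 ≤ c₁ := by rw [hc₁def]; positivity
  have h1W0 : φ₁ ⬝ᵥ W φ₀ = -(φ₁ ⬝ᵥ A φ₁) := by
    have : W φ₀ = -(A φ₁) + w₀ • φ₀ := by rw [hfirst]; simp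
    rw [this, dotProduct_add, dotProduct_neg, dotProduct_smul, h10, smul_eq_mul, mul_zero, add_zero]
  -- S2: Q and its lower bound
  set Q := ψ ⬝ᵥ (A ψ + η • W ψ) with hQdef
  have hψAψ : ψ ⬝ᵥ A ψ = χ ⬝ᵥ A χ := by
    conv_lhs => rw [hψχ]
    simp only [map_add, map_smul, hAφ₀, smul_zero, zero_add, add_dotProduct, smul_dotProduct, smul_eq_mul]
    rw [hA φ₀, hAφ₀, zero_dotProduct, mul_zero, zero_add]
  have hQsplit : Q = χ ⬝ᵥ A χ + η * (ψ ⬝ᵥ W ψ) := by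
    rw [hQdef, dotProduct_add, dotProduct_smul, hψAψ, smul_eq_mul]
  have hψW : |ψ ⬝ᵥ W ψ| ≤ wmax := by have := hWb ψ; rw [hψ, mul_one] at this; exact this
  have hχA : γ * (1 - α ^ 2) ≤ χ ⬝ᵥ A χ := by rw [← hχχ]; exact hgap χ h0χ
  have hQlow : γ * (1 - α ^ 2) - η * wmax ≤ Q := by
    have h := mul_le_mul_of_nonneg_left (abs_le.mp hψW).1 hη0
    rw [hQsplit]; linarith
  have hQl : -(η * wmax) ≤ Q := by have := mul_nonneg hγ.le h1α; linarith
  -- S3: the trial state t = φ₀ + η φ₁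
  have htt : (φ₀ + η • φ₁) ⬝ᵥ (φ₀ + η • φ₁) = 1 + η ^ 2 * p₁ := by
    simp only [add_dotProduct, dotProduct_add, smul_dotProduct, dotProduct_smul, h00, h01, h10, smul_eq_mul,
      mul_zero, add_zero, hp₁def]; ring
  have hqt : (φ₀ + η • φ₁) ⬝ᵥ (A (φ₀ + η • φ₁) + η • W (φ₀ + η • φ₁))
      = η * w₀ - η ^ 2 * (φ₁ ⬝ᵥ A φ₁) + η ^ 3 * (φ₁ ⬝ᵥ W φ₁) := by
    have r5 : φ₀ ⬝ᵥ W φ₁ = φ₁ ⬝ᵥ W φ₀ := by rw [hW, dotProduct_comm]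
    have r2 : φ₀ ⬝ᵥ A φ₁ = 0 := by rw [hA, hAφ₀, zero_dotProduct]
    simp only [map_add, map_smul, hAφ₀, zero_add, add_dotProduct, dotProduct_add, smul_dotProduct,
      dotProduct_smul, smul_eq_mul, r2, r5, h1W0, hw₀]
    ring
  have htrial := hmin (φ₀ + η • φ₁)
  rw [htt, hqt] at htrial
  -- Q ≤ η w₀ − η² a₁ + c₁ η³
  have hQup : Q ≤ η * w₀ - η ^ 2 * (φ₁ ⬝ᵥ A φ₁) + c₁ * η ^ 3 := by
    have key : Q * (1 + η ^ 2 * p₁) = Q + η ^ 2 * p₁ * Q := by ring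
    rw [key] at htrial
    have hQw : 0 ≤ Q + η * wmax := by linarith
    have h1 : 0 ≤ η ^ 2 * p₁ * (Q + η * wmax) := mul_nonneg (mul_nonneg hη2 hp₁) hQw
    have h2 : η ^ 3 * (φ₁ ⬝ᵥ W φ₁) ≤ η ^ 3 * |φ₁ ⬝ᵥ W φ₁| := mul_le_mul_of_nonneg_left (le_abs_self _) hη3
    rw [hc₁def]
    linarith
  -- S4: ‖χ‖² = O(η)
  have hK2 : γ * (1 - α ^ 2) ≤ K₂ * η := by
    have hw : η * w₀ ≤ η * |w₀| := mul_le_mul_of_nonneg_left (le_abs_self _) hη0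
    have h1 : 0 ≤ η ^ 2 * (φ₁ ⬝ᵥ A φ₁) := mul_nonneg hη2 ha₁0
    have h2 : c₁ * η ^ 3 ≤ c₁ * η := mul_le_mul_of_nonneg_left hη31 hc₁
    rw [hK₂def]; linarith
  -- S5: square completion ⇒ ρAρ = O(η²)
  have hsc := square_completion A W hA hW φ₀ φ₁ ρ η α w₀ hAφ₀ h01 h0ρ hfirst
  rw [← hψdec, hχdec, hw₀] at hsc
  have hρexpr : ρ ⬝ᵥ A ρ = Q - η * α ^ 2 * w₀ + η ^ 2 * α ^ 2 * (φ₁ ⬝ᵥ A φ₁) - η * (χ ⬝ᵥ W χ) := by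
    rw [hQdef, hsc]; ring
  have hχW : |χ ⬝ᵥ W χ| ≤ wmax * (1 - α ^ 2) := by rw [← hχχ]; exact hWb χ
  have hρAρ1 : ρ ⬝ᵥ A ρ ≤ η * (1 - α ^ 2) * (|w₀| + wmax) + c₁ * η ^ 3 := by
    rw [hρexpr]
    have hx := mul_le_mul_of_nonneg_left (abs_le.mp hχW).1 hη0
    have hw : η * ((1 - α ^ 2) * w₀) ≤ η * ((1 - α ^ 2) * |w₀|) :=
      mul_le_mul_of_nonneg_left (mul_le_mul_of_nonneg_left (le_abs_self _) h1α) hη0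
    have h1 : 0 ≤ η ^ 2 * ((1 - α ^ 2) * (φ₁ ⬝ᵥ A φ₁)) := mul_nonneg hη2 (mul_nonneg h1α ha₁0)
    linarith
  have hρgap : γ * (ρ ⬝ᵥ ρ) ≤ ρ ⬝ᵥ A ρ := hgap ρ h0ρ
  have hpos : 0 ≤ |w₀| + wmax := by positivity
  have hK3 : γ * (ρ ⬝ᵥ A ρ) ≤ K₃ * η ^ 2 := by
    have step := mul_le_mul_of_nonneg_left hρAρ1 hγ.le
    have h1 := mul_le_mul_of_nonneg_left hK2 (mul_nonneg hη0 hpos)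
    have h2 := mul_le_mul_of_nonneg_left hη32 (mul_nonneg hγ.le hc₁)
    rw [hK₃def]; linarith
  have hρρ : γ ^ 2 * (ρ ⬝ᵥ ρ) ≤ K₃ * η ^ 2 := by
    have := mul_le_mul_of_nonneg_left hρgap hγ.le
    linarith
  -- S6: ‖χ‖² = O(η²)
  have hχsplit : χ ⬝ᵥ χ ≤ 2 * ((η * α) ^ 2 * p₁) + 2 * (ρ ⬝ᵥ ρ) := by
    have h := dot_add_le ((η * α) • φ₁) ρ
    rw [hχdec] at h
    simp only [smul_dotProduct, dotProduct_smul, smul_eq_mul, ← hp₁def] at h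
    linarith
  have hK4 : γ ^ 2 * (1 - α ^ 2) ≤ K₄ * η ^ 2 := by
    rw [← hχχ, hK₄def]
    have hαη : (η * α) ^ 2 * p₁ ≤ η ^ 2 * p₁ := by
      have := mul_nonneg (mul_nonneg hη2 hp₁) h1α; linarith
    have h1 := mul_le_mul_of_nonneg_left hχsplit (sq_nonneg γ)
    have h2 := mul_le_mul_of_nonneg_left hαη (sq_nonneg γ)
    linarith
  refine ⟨hK4, ?_⟩
  -- S7: ρAρ = O(η³)
  have hρAρ2 : ρ ⬝ᵥ A ρ ≤ η * (1 - α ^ 2) * |w₀| + c₁ * η ^ 3 + η * |χ ⬝ᵥ W χ| := by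
    rw [hρexpr]
    have hx := mul_le_mul_of_nonneg_left (neg_le_abs (χ ⬝ᵥ W χ)) hη0
    have hw : η * ((1 - α ^ 2) * w₀) ≤ η * ((1 - α ^ 2) * |w₀|) :=
      mul_le_mul_of_nonneg_left (mul_le_mul_of_nonneg_left (le_abs_self _) h1α) hη0
    have h1 : 0 ≤ η ^ 2 * ((1 - α ^ 2) * (φ₁ ⬝ᵥ A φ₁)) := mul_nonneg hη2 (mul_nonneg h1α ha₁0)
    linarith
  have hχW2 : γ ^ 2 * |χ ⬝ᵥ W χ| ≤ wmax * (K₄ * η ^ 2) := by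
    calc γ ^ 2 * |χ ⬝ᵥ W χ| ≤ γ ^ 2 * (wmax * (1 - α ^ 2)) := mul_le_mul_of_nonneg_left hχW (sq_nonneg γ)
      _ = wmax * (γ ^ 2 * (1 - α ^ 2)) := by ring
      _ ≤ wmax * (K₄ * η ^ 2) := mul_le_mul_of_nonneg_left hK4 hwmax
  have hK5 : γ ^ 2 * (ρ ⬝ᵥ A ρ) ≤ K₅ * η ^ 3 := by
    have step := mul_le_mul_of_nonneg_left hρAρ2 (sq_nonneg γ)
    have t1 : η * (γ ^ 2 * (1 - α ^ 2)) * |w₀| ≤ η * (K₄ * η ^ 2) * |w₀| :=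
      mul_le_mul_of_nonneg_right (mul_le_mul_of_nonneg_left hK4 hη0) (abs_nonneg _)
    have t2 : η * (γ ^ 2 * |χ ⬝ᵥ W χ|) ≤ η * (wmax * (K₄ * η ^ 2)) := mul_le_mul_of_nonneg_left hχW2 hη0
    rw [hK₅def]; linarith
  have := mul_le_mul_of_nonneg_left hρgap (sq_nonneg γ)
  linarith

/-! ### the deficit expansion (memo §160 (γ3)) — square-root-free polarisation with a free parameter `s` -/

/-- polarisation for a positive semidefinite symmetric form: `2⟨x,By⟩ ≤ s⟨x,Bx⟩ + s⁻¹⟨y,By⟩`. -/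
theorem two_cross_le (B : (ι → ℝ) →ₗ[ℝ] (ι → ℝ)) (hB : ∀ f g : ι → ℝ, f ⬝ᵥ B g = B f ⬝ᵥ g)
    (hpsd : ∀ x : ι → ℝ, 0 ≤ x ⬝ᵥ B x) (x y : ι → ℝ) (s : ℝ) (hs : 0 < s) :
    2 * (x ⬝ᵥ B y) ≤ s * (x ⬝ᵥ B x) + s⁻¹ * (y ⬝ᵥ B y) := by
  have h := hpsd (s • x - y)
  have hyx : y ⬝ᵥ B x = x ⬝ᵥ B y := by rw [hB, dotProduct_comm]
  simp only [map_sub, map_smul, sub_dotProduct, dotProduct_sub, smul_dotProduct, dotProduct_smul, smul_eq_mul,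
    hyx] at h
  -- h : 0 ≤ s(s xBx) − s xBy − (s xBy − yBy) rearranged
  -- h : 0 ≤ P with P = s(s xBx − xBy) − (s xBy − yBy)  (a polynomial identity away from the claim × s)
  have hP : s * (s * (x ⬝ᵥ B x) - x ⬝ᵥ B y) - (s * (x ⬝ᵥ B y) - y ⬝ᵥ B y)
      = s * (s * (x ⬝ᵥ B x) + s⁻¹ * (y ⬝ᵥ B y) - 2 * (x ⬝ᵥ B y)) := by
    field_simp; ring
  have h' : 0 ≤ s * (s * (x ⬝ᵥ B x) + s⁻¹ * (y ⬝ᵥ B y) - 2 * (x ⬝ᵥ B y)) := by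
    have := h; rw [hP] at this; exact this
  have := (mul_nonneg_iff_of_pos_left hs).mp h'
  linarith

/-- **DEFICIT EXPANSION**: for psd symmetric `B` (`= A_⊤`, so `d_M = 2⟨χ,Bχ⟩` by H.6), `χ = ηαφ₁ + ρ`,
`⟨φ₁,Bφ₁⟩ = λ‖φ₁‖²` (LEMMA J2: `λ = 2S−1`) and `⟨ρ,Bρ⟩ ≤ β‖ρ‖²`: for every `0 < s ≤ 1`,
`|⟨χ,Bχ⟩ − η²α²λp₁| ≤ s·η²α²λp₁ + (1 + s⁻¹)·β‖ρ‖²` — with Part I `bootstrap` (‖ρ‖² = O(η³), 1 − α² = O(η²)) this is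
`d_M = 2η²λp₁ + O(s η² + η³/s)`; choosing `s` small and then `η` small gives strict ordering in `M` (§160 (γ4)). -/
theorem deficit_expansion (B : (ι → ℝ) →ₗ[ℝ] (ι → ℝ)) (hB : ∀ f g : ι → ℝ, f ⬝ᵥ B g = B f ⬝ᵥ g)
    (hpsd : ∀ x : ι → ℝ, 0 ≤ x ⬝ᵥ B x) (φ₁ ρ : ι → ℝ) (η α lam p₁ β s : ℝ)
    (hφ₁ : φ₁ ⬝ᵥ B φ₁ = lam * p₁) (hlam : 0 ≤ lam * p₁) (hρ : ρ ⬝ᵥ B ρ ≤ β * (ρ ⬝ᵥ ρ))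
    (hs : 0 < s) (hs1 : s ≤ 1) :
    |((η * α) • φ₁ + ρ) ⬝ᵥ B ((η * α) • φ₁ + ρ) - η ^ 2 * α ^ 2 * (lam * p₁)|
      ≤ s * (η ^ 2 * α ^ 2 * (lam * p₁)) + (1 + s⁻¹) * (β * (ρ ⬝ᵥ ρ)) := by
  have hρφ : ρ ⬝ᵥ B φ₁ = φ₁ ⬝ᵥ B ρ := by rw [hB, dotProduct_comm]
  have hexp : ((η * α) • φ₁ + ρ) ⬝ᵥ B ((η * α) • φ₁ + ρ)
      = η ^ 2 * α ^ 2 * (lam * p₁) + 2 * ((η * α) * (φ₁ ⬝ᵥ B ρ)) + ρ ⬝ᵥ B ρ := by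
    simp only [map_add, map_smul, add_dotProduct, dotProduct_add, smul_dotProduct, dotProduct_smul, smul_eq_mul,
      hφ₁, hρφ]; ring
  rw [hexp]
  have hup := two_cross_le B hB hpsd ((η * α) • φ₁) ρ s hs
  have hdn := two_cross_le B hB hpsd ((η * α) • φ₁) (-ρ) s hs
  simp only [map_smul, map_neg, smul_dotProduct, dotProduct_smul, dotProduct_neg, neg_dotProduct, neg_neg,
    smul_eq_mul, hφ₁] at hup hdn
  have hρ0 : 0 ≤ ρ ⬝ᵥ B ρ := hpsd ρ
  have hsinv : 0 ≤ s⁻¹ := inv_nonneg.mpr hs.le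
  have hsinv1 : 1 ≤ s⁻¹ := one_le_inv_iff₀.mpr ⟨hs, hs1⟩
  have hρρ0 : 0 ≤ ρ ⬝ᵥ ρ := dot_self_nonneg ρ
  have hβρ : ρ ⬝ᵥ B ρ ≤ β * (ρ ⬝ᵥ ρ) := hρ
  have hmain0 : 0 ≤ η ^ 2 * α ^ 2 * (lam * p₁) := by positivity
  rw [abs_le]; constructor
  · -- lower
    have h1 : s⁻¹ * (ρ ⬝ᵥ B ρ) ≤ s⁻¹ * (β * (ρ ⬝ᵥ ρ)) := mul_le_mul_of_nonneg_left hβρ hsinv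
    have h2 : 0 ≤ β * (ρ ⬝ᵥ ρ) := le_trans hρ0 hβρ
    nlinarith [hdn, h1, h2, hρ0]
  · -- upper
    have h1 : s⁻¹ * (ρ ⬝ᵥ B ρ) ≤ s⁻¹ * (β * (ρ ⬝ᵥ ρ)) := mul_le_mul_of_nonneg_left hβρ hsinv
    nlinarith [hup, h1, hβρ]

end Summit.HubbardSuperconductivity.HubbardSuperconductivity.Theorems.AnisotropyChord.Tower
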